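import Mathlib.Analysis.SpecialFunctions.Sqrt
import Mathlib.Analysis.SpecialFunctions.Trigonometric.DerivHyp
import Summits.AtomisticToContinuum.BoseEinsteinCondensation.Theorems.BECThomsonPrincipleDensityResponseTransportFlow

/-!
# Route `BECThomsonPrinciple`, crux `DensityResponse` (stmt-AtomisticToContinuum-9481),
# line `force-balance-constitutive` — sub-goal `stub_transportState` of stub S1
# (`TransportStationary`)

The TRANSPORTED WAVE FUNCTION of the transport step of S1. With the configuration-space transport
flow `F_τ = transportFlow L n τ` (`Theorems/BECThomsonPrincipleDensityResponseTransportFlow.lean`)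
and its Jacobian `det DF_{-τ}(X) = ∏ᵢ (cosh τ + cos θᵢ sinh τ)⁻¹`, `θᵢ = k·xᵢ`, the transported
state is

  `Φ^τ(X) = Φ(F_{-τ} X) · J_τ(X)`,
  `J_τ(X) = ∏ᵢ (cosh τ + cos θᵢ(X) sinh τ)^{-1/2} = (det DF_{-τ}(X))^{1/2}`

(`transportFun L n τ ψ`, weight `transportWeight L n τ`; `Φ^τ = e^{-τD}Φ` for
`D = U·∇ + ½ div U`, `U = (u_k(x₁), …, u_k(x_N))`). Contents (elementary; no named facts):

* the half-density Jacobian weight: positivity,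
  `J_τ² = ∏ᵢ (cosh τ + cos θᵢ sinh τ)⁻¹ = det DF_{-τ}`,
  smoothness in `X` and jointly in `(τ, X)`, lattice periodicity and permutation invariance;
* `transportFun`: `C^m` in `X` (and jointly in `(τ, X)`) when `ψ` is `C^m`, lattice periodicity and
  Bose symmetry inherited from `ψ`, and the pointwise PUSH-FORWARD DENSITY identity
  `|Φ^τ(X)|² = |Φ(F_{-τ}X)|² · |det DF_{-τ}(X)|` (real, and in the `ℝ≥0∞` form of the cell
  integrals),
  i.e. exactly the integrand of the torus change-of-variables formula, so that
  `∫_cell |Φ^τ|² = ∫_cell |Φ|² = 1` once that formula is supplied.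

The registered sub-goal `stub_transportState` packages these properties. The normalisation itself
(hence `Φ^τ ∈ PeriodicTrialState N L`) waits for the Literature change-of-variables theorem for
lattice-equivariant `C¹` diffeomorphisms of the cell and is deliberately NOT in this file.
-/

namespace Summit.AtomisticToContinuum.BoseEinsteinCondensation.Cruxes.DensityResponse.ForceBalanceConstitutive

noncomputable section

open Real
open scoped ENNReal
open Literature.MathematicalPhysics.QuantumManyBody.BoseGas

variable {N : ℕ}

/-! ### The half-density Jacobian weight -/

/-- `D(-τ, θ) = cosh τ + cos θ sinh τ > 0`. [folklore] -/
theorem jacFactor_neg_pos (τ θ : ℝ) : 0 < cosh τ + cos θ * sinh τ := by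
  have h := jacFactor_pos (-τ) θ
  rwa [cosh_neg, sinh_neg, mul_neg, sub_neg_eq_add] at h

/-- The HALF-DENSITY JACOBIAN WEIGHT `J_τ(X) = ∏ᵢ (cosh τ + cos θᵢ(X) sinh τ)^{-1/2}`
(`= (det DF_{-τ}(X))^{1/2}`). -/
def transportWeight (L : ℝ) (n : Fin 3 → ℤ) (τ : ℝ) (X : Config N) : ℝ :=
  ∏ i, (Real.sqrt (cosh τ + cos (phase L n X i) * sinh τ))⁻¹

/-- `J_τ(X) > 0`. [folklore] -/
theorem transportWeight_pos (L : ℝ) (n : Fin 3 → ℤ) (τ : ℝ) (X : Config N) :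
    0 < transportWeight L n τ X :=
  Finset.prod_pos fun i _ => inv_pos.mpr (Real.sqrt_pos.mpr (jacFactor_neg_pos τ (phase L n X i)))

/-- `J_τ(X)² = ∏ᵢ (cosh τ + cos θᵢ sinh τ)⁻¹`. [folklore] -/
theorem transportWeight_sq (L : ℝ) (n : Fin 3 → ℤ) (τ : ℝ) (X : Config N) :
    transportWeight L n τ X ^ 2 = ∏ i, (cosh τ + cos (phase L n X i) * sinh τ)⁻¹ := by
  rw [transportWeight, ← Finset.prod_pow]
  exact Finset.prod_congr rfl fun i _ => by rw [inv_pow, Real.sq_sqrt (jacFactor_neg_pos τ _).le]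

/-- `det DF_{-τ}(X) = ∏ᵢ (cosh τ + cos θᵢ sinh τ)⁻¹`. [folklore] -/
theorem det_transportDeriv_neg {L : ℝ} {n : Fin 3 → ℤ} (hk : ksq L n ≠ 0) (τ : ℝ) (X : Config N) :
    (transportDeriv L n (-τ) X).det = ∏ i, (cosh τ + cos (phase L n X i) * sinh τ)⁻¹ := by
  rw [det_transportDeriv hk]
  simp only [cosh_neg, sinh_neg, mul_neg, sub_neg_eq_add]

/-- `J_τ(X)² = det DF_{-τ}(X)`. [folklore] -/
theorem transportWeight_sq_eq_det {L : ℝ} {n : Fin 3 → ℤ} (hk : ksq L n ≠ 0) (τ : ℝ)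
    (X : Config N) : transportWeight L n τ X ^ 2 = (transportDeriv L n (-τ) X).det := by
  rw [transportWeight_sq, det_transportDeriv_neg hk]

/-- The Jacobian factors along a trajectory are reciprocal: `D(-τ, θ + δ(τ,θ)) = D(τ, θ)⁻¹`, i.e.
`cosh τ + cos(θ + δ) sinh τ = (cosh τ - cos θ sinh τ)⁻¹` (inverse-function rule for the angle flow).
[folklore] -/
theorem jacFactor_neg_add_angleFlow (τ θ : ℝ) :
    cosh τ + cos (θ + angleFlow τ θ) * sinh τ = (cosh τ - cos θ * sinh τ)⁻¹ := by
  have hc := cos_add_angleFlow_mul τ θ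
  refine eq_inv_of_mul_eq_one_left ?_
  linear_combination sinh τ * hc + Real.cosh_sq τ

/-- IN FLATTENED VARIABLES `X = F_τ(Y)`: `J_τ(F_τ Y)² = (det DF_τ(Y))⁻¹`. [folklore] -/
theorem transportWeight_transportFlow_sq {L : ℝ} {n : Fin 3 → ℤ} (hk : ksq L n ≠ 0) (τ : ℝ)
    (Y : Config N) :
    transportWeight L n τ (transportFlow L n τ Y) ^ 2 = ((transportDeriv L n τ Y).det)⁻¹ := by
  rw [transportWeight_sq, det_transportDeriv hk, ← Finset.prod_inv_distrib]
  refine Finset.prod_congr rfl fun i _ => ?_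
  rw [phase_transportFlow hk, jacFactor_neg_add_angleFlow, inv_inv]

/-- IN FLATTENED VARIABLES: `J_τ(F_τ Y) = ∏ᵢ (cosh τ - cos θᵢ(Y) sinh τ)^{1/2}`. [folklore] -/
theorem transportWeight_transportFlow {L : ℝ} {n : Fin 3 → ℤ} (hk : ksq L n ≠ 0) (τ : ℝ)
    (Y : Config N) : transportWeight L n τ (transportFlow L n τ Y) =
      ∏ i, Real.sqrt (cosh τ - cos (phase L n Y i) * sinh τ) := by
  unfold transportWeight
  refine Finset.prod_congr rfl fun i _ => ?_
  rw [phase_transportFlow hk, jacFactor_neg_add_angleFlow, Real.sqrt_inv, inv_inv]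

/-- `J_τ` is `C^m` in `X` for every `m`. [folklore] -/
theorem contDiff_transportWeight (L : ℝ) (n : Fin 3 → ℤ) (τ : ℝ) {m : WithTop ℕ∞} :
    ContDiff ℝ m (transportWeight (N := N) L n τ) := by
  unfold transportWeight
  refine contDiff_prod fun i _ => ?_
  have hD : ContDiff ℝ m fun X : Config N => cosh τ + cos (phase L n X i) * sinh τ :=
    contDiff_const.add ((contDiff_cos.comp (contDiff_phase L n i)).mul contDiff_const)
  exact (hD.sqrt fun X => (jacFactor_neg_pos τ _).ne').inv fun X =>
    (Real.sqrt_pos.mpr (jacFactor_neg_pos τ _)).ne'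

/-- `(τ, X) ↦ J_τ(X)` is jointly `C^m`. [folklore] -/
theorem contDiff_transportWeight_uncurry (L : ℝ) (n : Fin 3 → ℤ) {m : WithTop ℕ∞} :
    ContDiff ℝ m fun p : ℝ × Config N => transportWeight L n p.1 p.2 := by
  unfold transportWeight
  refine contDiff_prod fun i _ => ?_
  have hD : ContDiff ℝ m fun p : ℝ × Config N => cosh p.1 + cos (phase L n p.2 i) * sinh p.1 :=
    (contDiff_cosh.comp contDiff_fst).add
      ((contDiff_cos.comp ((contDiff_phase L n i).comp contDiff_snd)).mul
        (contDiff_sinh.comp contDiff_fst))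
  exact (hD.sqrt fun p => (jacFactor_neg_pos _ _).ne').inv fun p =>
    (Real.sqrt_pos.mpr (jacFactor_neg_pos _ _)).ne'

/-- `J_τ` is lattice periodic. [folklore] -/
theorem transportWeight_add_single (L : ℝ) (n : Fin 3 → ℤ) (τ : ℝ) (X : Config N) (i : Fin N)
    (c : Fin 3) :
    transportWeight L n τ (X + Pi.single i (EuclideanSpace.single c L)) =
      transportWeight L n τ X := by
  unfold transportWeight
  refine Finset.prod_congr rfl fun i' _ => ?_
  obtain ⟨m, hm⟩ := exists_phase_add_single L n X i c i'
  rw [hm, cos_add_int_mul_two_pi]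

/-- `J_τ` is permutation invariant. [folklore] -/
theorem transportWeight_comp_perm (L : ℝ) (n : Fin 3 → ℤ) (τ : ℝ) (σ : Equiv.Perm (Fin N))
    (X : Config N) : transportWeight L n τ (X ∘ σ) = transportWeight L n τ X :=
  Fintype.prod_equiv σ _ _ fun _ => rfl

/-! ### The transported wave function -/

/-- The TRANSPORTED WAVE FUNCTION `Φ^τ(X) = ψ(F_{-τ} X) · J_τ(X)` (push-forward of `ψ` by the flow
`F_τ` with the half-density Jacobian weight; `Φ^τ = e^{-τD} ψ`, `D = U·∇ + ½ div U`). -/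
def transportFun (L : ℝ) (n : Fin 3 → ℤ) (τ : ℝ) (ψ : Config N → ℂ) (X : Config N) : ℂ :=
  ψ (transportFlow L n (-τ) X) * (transportWeight L n τ X : ℂ)

/-- Unfolding `transportFun`. [folklore] -/
theorem transportFun_apply (L : ℝ) (n : Fin 3 → ℤ) (τ : ℝ) (ψ : Config N → ℂ) (X : Config N) :
    transportFun L n τ ψ X = ψ (transportFlow L n (-τ) X) * (transportWeight L n τ X : ℂ) := rfl

/-- The product form `Φ^τ(X) = ψ(F_{-τ}X) · ∏ᵢ (√(cosh τ + cos θᵢ sinh τ))⁻¹` with the factors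
coerced to `ℂ` one by one. [folklore] -/
theorem transportFun_eq_mul_prod (L : ℝ) (n : Fin 3 → ℤ) (τ : ℝ) (ψ : Config N → ℂ)
    (X : Config N) : transportFun L n τ ψ X = ψ (transportFlow L n (-τ) X) *
      ∏ i, ((Real.sqrt (cosh τ + cos (phase L n X i) * sinh τ) : ℝ) : ℂ)⁻¹ := by
  rw [transportFun_apply, transportWeight, Complex.ofReal_prod]
  simp only [Complex.ofReal_inv]

/-- `Φ^0 = ψ`. [folklore] -/
theorem transportFun_zero (L : ℝ) (n : Fin 3 → ℤ) (ψ : Config N → ℂ) :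
    transportFun L n 0 ψ = ψ := by
  funext X
  rw [transportFun_apply, neg_zero, transportFlow_zero, transportWeight]
  simp only [cosh_zero, sinh_zero, mul_zero, add_zero, Real.sqrt_one, inv_one,
    Finset.prod_const_one, Complex.ofReal_one, mul_one]

/-- `Φ^τ` is `C^m` when `ψ` is. [folklore] -/
theorem contDiff_transportFun (L : ℝ) (n : Fin 3 → ℤ) (τ : ℝ) {m : WithTop ℕ∞} {ψ : Config N → ℂ}
    (hψ : ContDiff ℝ m ψ) : ContDiff ℝ m (transportFun L n τ ψ) := by
  have h1 : ContDiff ℝ m fun X : Config N => ψ (transportFlow L n (-τ) X) :=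
    hψ.comp (contDiff_transportFlow L n (-τ))
  have h2 : ContDiff ℝ m fun X : Config N => (transportWeight L n τ X : ℂ) :=
    Complex.ofRealCLM.contDiff.comp (contDiff_transportWeight L n τ)
  exact h1.mul h2

/-- `(τ, X) ↦ Φ^τ(X)` is jointly `C^m` when `ψ` is `C^m`. [folklore] -/
theorem contDiff_transportFun_uncurry (L : ℝ) (n : Fin 3 → ℤ) {m : WithTop ℕ∞} {ψ : Config N → ℂ}
    (hψ : ContDiff ℝ m ψ) : ContDiff ℝ m fun p : ℝ × Config N => transportFun L n p.1 ψ p.2 := by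
  have h1 : ContDiff ℝ m fun p : ℝ × Config N => ψ (transportFlow L n (-p.1) p.2) :=
    hψ.comp ((contDiff_transportFlow_uncurry L n).comp (contDiff_fst.neg.prodMk contDiff_snd))
  have h2 : ContDiff ℝ m fun p : ℝ × Config N => (transportWeight L n p.1 p.2 : ℂ) :=
    Complex.ofRealCLM.contDiff.comp (contDiff_transportWeight_uncurry L n)
  exact h1.mul h2

/-- `Φ^τ` inherits lattice periodicity from `ψ`. [folklore] -/
theorem transportFun_add_single (L : ℝ) (n : Fin 3 → ℤ) (τ : ℝ) {ψ : Config N → ℂ}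
    (hψ : ∀ (X : Config N) (i : Fin N) (c : Fin 3),
      ψ (X + Pi.single i (EuclideanSpace.single c L)) = ψ X)
    (X : Config N) (i : Fin N) (c : Fin 3) :
    transportFun L n τ ψ (X + Pi.single i (EuclideanSpace.single c L)) =
      transportFun L n τ ψ X := by
  rw [transportFun_apply, transportFun_apply, transportFlow_add_single, hψ,
    transportWeight_add_single]

/-- `Φ^τ` inherits Bose symmetry from `ψ`. [folklore] -/
theorem transportFun_comp_perm (L : ℝ) (n : Fin 3 → ℤ) (τ : ℝ) {ψ : Config N → ℂ}
    (hψ : ∀ (σ : Equiv.Perm (Fin N)) (X : Config N), ψ (X ∘ σ) = ψ X) (σ : Equiv.Perm (Fin N))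
    (X : Config N) : transportFun L n τ ψ (X ∘ σ) = transportFun L n τ ψ X := by
  rw [transportFun_apply, transportFun_apply, transportFlow_comp_perm, hψ,
    transportWeight_comp_perm]

/-- `|Φ^τ(X)| = |ψ(F_{-τ}X)| · J_τ(X)`. [folklore] -/
theorem norm_transportFun (L : ℝ) (n : Fin 3 → ℤ) (τ : ℝ) (ψ : Config N → ℂ) (X : Config N) :
    ‖transportFun L n τ ψ X‖ = ‖ψ (transportFlow L n (-τ) X)‖ * transportWeight L n τ X := by
  rw [transportFun_apply, norm_mul, Complex.norm_of_nonneg (transportWeight_pos L n τ X).le]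

/-- THE PUSH-FORWARD DENSITY: `|Φ^τ(X)|² = |ψ(F_{-τ}X)|² ∏ᵢ (cosh τ + cos θᵢ sinh τ)⁻¹`.
[folklore] -/
theorem norm_sq_transportFun (L : ℝ) (n : Fin 3 → ℤ) (τ : ℝ) (ψ : Config N → ℂ) (X : Config N) :
    ‖transportFun L n τ ψ X‖ ^ 2 =
      ‖ψ (transportFlow L n (-τ) X)‖ ^ 2 * ∏ i, (cosh τ + cos (phase L n X i) * sinh τ)⁻¹ := by
  rw [norm_transportFun, mul_pow, transportWeight_sq]

/-- `|Φ^τ(X)|² = |ψ(F_{-τ}X)|² · |det DF_{-τ}(X)|` — the integrand of the change-of-variables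
formula for `Y = F_{-τ}X`. [folklore] -/
theorem norm_sq_transportFun_eq_det {L : ℝ} {n : Fin 3 → ℤ} (hk : ksq L n ≠ 0) (τ : ℝ)
    (ψ : Config N → ℂ) (X : Config N) :
    ‖transportFun L n τ ψ X‖ ^ 2 =
      ‖ψ (transportFlow L n (-τ) X)‖ ^ 2 * |(transportDeriv L n (-τ) X).det| := by
  rw [norm_transportFun, mul_pow, transportWeight_sq_eq_det hk,
    abs_of_pos (det_transportDeriv_pos hk _ _)]

/-- The same in the `ℝ≥0∞` form of the cell integrals:
`‖Φ^τ(X)‖₊² = ‖ψ(F_{-τ}X)‖₊² · ofReal |det DF_{-τ}(X)|`. [folklore] -/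
theorem nnnorm_sq_transportFun_eq_det {L : ℝ} {n : Fin 3 → ℤ} (hk : ksq L n ≠ 0) (τ : ℝ)
    (ψ : Config N → ℂ) (X : Config N) :
    ((‖transportFun L n τ ψ X‖₊ : ℝ≥0∞)) ^ 2 =
      ((‖ψ (transportFlow L n (-τ) X)‖₊ : ℝ≥0∞)) ^ 2 *
        ENNReal.ofReal |(transportDeriv L n (-τ) X).det| := by
  rw [coe_nnnorm_sq_eq_ofReal, coe_nnnorm_sq_eq_ofReal, norm_sq_transportFun_eq_det hk,
    ENNReal.ofReal_mul (sq_nonneg _)]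

/-- IN FLATTENED VARIABLES: `Φ^τ(F_τ Y) = ψ(Y) · J_τ(F_τ Y)`. [folklore] -/
theorem transportFun_transportFlow (L : ℝ) (n : Fin 3 → ℤ) (τ : ℝ) (ψ : Config N → ℂ)
    (Y : Config N) : transportFun L n τ ψ (transportFlow L n τ Y) =
      ψ Y * (transportWeight L n τ (transportFlow L n τ Y) : ℂ) := by
  rw [transportFun_apply, transportFlow_neg_transportFlow]

/-- IN FLATTENED VARIABLES: `|Φ^τ(F_τ Y)|² · det DF_τ(Y) = |ψ(Y)|²` (the density transported
back). [folklore] -/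
theorem norm_sq_transportFun_transportFlow_mul_det {L : ℝ} {n : Fin 3 → ℤ} (hk : ksq L n ≠ 0)
    (τ : ℝ) (ψ : Config N → ℂ) (Y : Config N) :
    ‖transportFun L n τ ψ (transportFlow L n τ Y)‖ ^ 2 * (transportDeriv L n τ Y).det =
      ‖ψ Y‖ ^ 2 := by
  rw [norm_transportFun, mul_pow, transportFlow_neg_transportFlow,
    transportWeight_transportFlow_sq hk, mul_assoc,
    inv_mul_cancel₀ (det_transportDeriv_pos hk τ Y).ne', mul_one]

/-! ### The registered sub-goal -/

/-- **Registered sub-goal `stub_transportState` of S1** (line `force-balance-constitutive`, crux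
stmt-AtomisticToContinuum-9481): the transported wave function `Φ^τ = (ψ ∘ F_{-τ}) · J_τ` is `C¹`
when `ψ` is, inherits lattice periodicity and Bose symmetry from `ψ`, and its density is the
push-forward density
`|Φ^τ|² = |ψ ∘ F_{-τ}|² · ∏ᵢ (cosh τ + cos θᵢ sinh τ)⁻¹ = |ψ ∘ F_{-τ}|² · |det DF_{-τ}|`, with the
flattened form `|Φ^τ ∘ F_τ|² · det DF_τ = |ψ|²`. [folklore] -/
theorem stub_transportState : ∀ (N : ℕ) (L : ℝ) (n : Fin 3 → ℤ) (τ : ℝ)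
    (ψ : (Fin N → EuclideanSpace ℝ (Fin 3)) → ℂ),
    (ContDiff ℝ 1 ψ → ContDiff ℝ 1 (transportFun L n τ ψ)) ∧
    ((∀ (X : Fin N → EuclideanSpace ℝ (Fin 3)) (i : Fin N) (c : Fin 3),
        ψ (X + Pi.single i (EuclideanSpace.single c L)) = ψ X) →
      ∀ (X : Fin N → EuclideanSpace ℝ (Fin 3)) (i : Fin N) (c : Fin 3),
        transportFun L n τ ψ (X + Pi.single i (EuclideanSpace.single c L)) =
          transportFun L n τ ψ X) ∧
    ((∀ (σ : Equiv.Perm (Fin N)) (X : Fin N → EuclideanSpace ℝ (Fin 3)), ψ (X ∘ σ) = ψ X) →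
      ∀ (σ : Equiv.Perm (Fin N)) (X : Fin N → EuclideanSpace ℝ (Fin 3)),
        transportFun L n τ ψ (X ∘ σ) = transportFun L n τ ψ X) ∧
    (∀ X : Fin N → EuclideanSpace ℝ (Fin 3), ‖transportFun L n τ ψ X‖ ^ 2 =
      ‖ψ (transportFlow L n (-τ) X)‖ ^ 2 *
        ∏ i, (Real.cosh τ + Real.cos (phase L n X i) * Real.sinh τ)⁻¹) ∧
    (ksq L n ≠ 0 → (∀ X : Fin N → EuclideanSpace ℝ (Fin 3), ‖transportFun L n τ ψ X‖ ^ 2 =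
        ‖ψ (transportFlow L n (-τ) X)‖ ^ 2 * |(transportDeriv L n (-τ) X).det|) ∧
      ∀ Y : Fin N → EuclideanSpace ℝ (Fin 3),
        ‖transportFun L n τ ψ (transportFlow L n τ Y)‖ ^ 2 * (transportDeriv L n τ Y).det =
          ‖ψ Y‖ ^ 2) :=
  fun _ L n τ _ => ⟨contDiff_transportFun L n τ, transportFun_add_single L n τ,
    transportFun_comp_perm L n τ,
    norm_sq_transportFun L n τ _, fun hk => ⟨norm_sq_transportFun_eq_det hk τ _,
      norm_sq_transportFun_transportFlow_mul_det hk τ _⟩⟩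

end

end Summit.AtomisticToContinuum.BoseEinsteinCondensation.Cruxes.DensityResponse.ForceBalanceConstitutive
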